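import Summits.AtomisticToContinuum.FouriersLaw.Theses.LocalOhmBV
import Summits.AtomisticToContinuum.FouriersLaw.Theses.TransferKernelPositivity
import Summits.AtomisticToContinuum.FouriersLaw.Theorems.LocalOhmBVLocalOhmReduction
import Summits.AtomisticToContinuum.FouriersLaw.Theorems.LocalOhmBVLocalOhmStubSoftExtractionWeakSqrt
import Summits.AtomisticToContinuum.FouriersLaw.Theorems.LocalOhmBVLocalOhmStubNoUnitCurrentOfZeroDrudeVar

/-!
# Skeleton of line `registered` (birth) for the crux `LocalOhmBV.LocalOhm` — v11 (lead c5, 2026-08-17: reshaped v9 + waves 1–2 landed)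
(crux item stmt-AtomisticToContinuum-12009, rank 2 of route `route-AtomisticToContinuum-LocalOhmBV`, shared with
`TransferKernelPositivity.LocalOhm`; published as `Cruxes/LocalOhm/Lines/birth.lean`)

Crux (FIXED, concluded BY NAME below): `Summit.AtomisticToContinuum.FouriersLaw.Theses.LocalOhmBV.LocalOhm` — for
`pinnedChain ω₂ lam β γ` (all `> 0`), under weak-NESS uniqueness, along any steady-state family and every `T > 0` there are
`C, ℓ, b` (NOT depending on `N`) such that for every `N`, every response coefficient `d = D_N` and every kinetic-temperature
response profile `θ = θ_N`, at every bulk bond `x` (`b ≤ x ≤ N-b-2`): `|d|/(N-1) ≤ C · Σ_{bonds (i,i+1), |i-x| ≤ ℓ} |θ(i+1) - θ(i)|`.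

## History of the line (compactness + linearised odd-sector rigidity, Eyink–Lebowitz–Spohn linearised at `μ_T`)

birth (planner): S1 interior LTE estimate, S2 blow-up extraction, S3 odd-sector Liouville. Lead c3: S3 symmetrised, S2 split
(S2a/S2b/S2c). Lead c4: S2b♭ ↦ T1/T2 (per-observable window–energy covariance bound), S2c ↦ S2c'; EVERYTHING but S1, S3 landed
(`Theorems/LocalOhmBVLocalOhmReduction.lean` p159151: `blowUpLimit` unconditional, glue `(S1) → (S3) → LocalOhm`).

## This reshape (lead c5): cut the two open stubs at their natural joints

* S1 ↦ **S1♯ `stub_linearisedLTESharp`** — the interior linearised-LTE estimate at its natural CLT scale `A(ℓ) = A √(ℓ+1)`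
  (`∃ A ∀ ℓ ∃ b` instead of `∀ ℓ ∃ b A`). The `√ℓ` growth is FORCED (the LTE-gradient part of the window response has
  `L²`-size `≍ ℓ^{3/2} |∇θ|` against the allowance `A(ℓ) · WV_x(ℓ) ≍ A(ℓ) ℓ |∇θ|`) and is the CLT size of the window density of
  any extensive perturbation (attained at the harmonic corner); nothing believed false is added (lead c3, PROMOTE-c3.md).
* S2c' ↦ **T♯1 `stub_softExtractionWeakSqrt`** (classical; the landed proof of `stub_softExtractionWeak` with `A := A √(n+1)`:
  its regularity clause is literally `A'(n) = 2|A(n)|`): fed with S1♯ the bad functional is `√n`-REGULAR,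
  `|Λ(g ∘ box_{a,n})| ≤ A' √(n+1) ‖g ∘ box_{a,n}‖_{L²(μ∞)}`. `blowUpLimitSqrt` below composes it with the landed packages.
* S3 ↦ **VZD `stub_zeroDrudeVar`** (OPEN; the anharmonic heart) — VARIATIONAL ZERO CURRENT DRUDE WEIGHT IN THE ODD SECTOR, a
  statement about the Gibbs state `μ_T` of the infinite chain ALONE (no dynamics, no functional): for every `ε > 0` there are a
  local `C¹` observable `G` and a local momentum-EVEN observable `E` such that the block sums of
  `f_x = j_x − 𝒜(G ∘ box_{a+x,n}) − E ∘ box_{a+x,n}` have `∫ (Σ_{x ≤ M} f_x)² dμ_T ≤ ε (M+1)` for arbitrarily large `M` —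
  i.e. `inf_{G,E} ‖j_0 − 𝒜G − E‖_{ℋ₀} = 0`: the odd part of the current density is a zero-wavenumber limit of microscopic time
  derivatives. In the `√n`-regular class this is EQUIVALENT to the old S3 (⇐: T♯4 below; ⇒: Riesz representation in `ℋ₀` + the
  in-tree exponential ρ-mixing `exists_regular_state_mixing_pinnedChain`), so the reshape removes exactly the completeness
  excess of S3 (functionals with `A(n) ≫ √n`, which the extraction never produces once S1 is stated at its scale). It is what a
  finite Green–Kubo conductivity without Drude atom gives (`j = z u_z − 𝒜 u_z`, `‖z u_z‖²_{ℋ₀} = z Re⟨⟨j, u_z⟩⟩ → 0`), it is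
  FALSE at `lam = β = 0` (the conserved harmonic energy current `J`: `⟨⟨𝒜G, J⟩⟩ = 0`, `⟨⟨E, j⟩⟩ = 0`, `⟨⟨j_0, J⟩⟩ > 0`), and it
  is the statement to SHARE with the Drude-weight cruxes (`NoHiddenChargesKubo.NoOddDrudeWeight` stmt-17667 is its Cesàro /
  dynamical shadow).
* **T♯4 `stub_noUnitCurrent_of_zeroDrudeVar`** (classical bridge, replaces the symmetry reduction + S3): VZD ⇒ no linear,
  `√n`-regular, `liouvilleZ`-invariant functional has unit current on every bond. Proof sketch: with `Λ⁻ f = (Λ f − Λ(f∘R))/2`,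
  `Λ⁻(j_x) = 1`, `Λ⁻(𝒜G_x) = 0` (`liouvilleZ_comp_momentumReversalZ` + invariance), `Λ⁻(E_x) = 0` (`E` even), so by linearity on
  the common box `Λ⁻(Σ_{x≤M} f_x) = M + 1`, while `√n`-regularity (and `μ_T ∘ R = μ_T`) gives
  `|Λ⁻(Σ_{x≤M} f_x)| ≤ A √(n+M+3) · √(ε (M+1))`; `M → ∞` along the hypothesis and `2A²ε < 1` is the contradiction.
* `LocalOhm_of : LocalOhm` — kernel-checked composition: violating sequence (diagonal `C = ℓ = b = k`) → `blowUpLimitSqrt`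
  (S1♯, T♯1, landed S2a/S2b') → T♯4 with VZD → `False`.

Stubs (registered, 2 — both OPEN, both named problems): `stub_linearisedLTESharp` (S1♯, XL) and `stub_zeroDrudeVar` (VZD, XL, held by
the lead). LANDED in wave 1 of lead c5: T♯1 `LocalOhmBirth.stub_softExtractionWeakSqrt` (p162063,
`Theorems/LocalOhmBVLocalOhmStubSoftExtractionWeakSqrt.lean`) and T♯4 `LocalOhmBirth.stub_noUnitCurrent_of_zeroDrudeVar` (p163112 +
Aux1 p162953, `Theorems/LocalOhmBVLocalOhmStubNoUnitCurrentOfZeroDrudeVar{,Aux1}.lean`); they are IMPORTED and used by name below.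
Calibration of S1♯ (worker, evidence S1SHARP-CALIBRATION.md): at the harmonic corner the CLT scale `√(ℓ+1)` is attained and not
exceeded, `N`-uniformly (bulk response = pure current mode), so S1♯ is consistent exactly where it is claimed to hold.
Calibration of VZD, KERNEL-CHECKED (cycle 2 of lead c5): `LocalOhmBirth.zeroDrudeVar_false_harmonic` and
`LocalOhmBirth.oddSectorLiouvilleSym_false_harmonic` (`Theorems/LocalOhmBVLocalOhmHarmonicCounterexample.lean`, p166540; witness
`exists_unitCurrentFunctional_harmonic` = the harmonic conserved-current functional `Σ_z Cov(·, j_z)/c`, helpers p164229 p165022 p164299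
p164398 p164021 p165857): the conclusions of VZD and of the old S3 FAIL for `pinnedChain ω₂ 0 0 γ` — any proof must use `lam, β > 0`.
Disproof used: none exists (`ledger crux ls`: no `Disproof.lean`, no `Negative/`). Interface warnings kept: `Λ` stays
`L²(μ_T)`-regular with translation-uniform constants; `μ∞` is the shift-invariant Gibbs state (unique, in tree).
-/

set_option autoImplicit false

noncomputable section

namespace Summit.AtomisticToContinuum.FouriersLaw.Cruxes.LocalOhm.Birth

open MeasureTheory Filter Topology
open scoped BigOperators
open Literature.MathematicalPhysics.KineticTheory.HeatConduction
open Summit.AtomisticToContinuum.FouriersLaw.Theses.LocalOhmBV (LocalOhm)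
open Summit.AtomisticToContinuum.FouriersLaw.Theorems.WindowLimit (embed)
open Summit.AtomisticToContinuum.FouriersLaw.Theorems.LocalOhmBirth

set_option linter.unusedVariables false

/-! ## S1♯ — linearised local equilibrium with an a-priori remainder at the CLT scale -/

/-- **S1♯ `stub_linearisedLTESharp`** (INTERIOR A-PRIORI ESTIMATE at the CLT scale; size XL; open — no `N`-uniform interior
estimate for a deterministic anharmonic bulk exists in tree or print, BLR2000 §7). For `P = pinnedChain ω₂ lam β γ` (all `> 0`),
under weak-NESS uniqueness, along any steady-state family `μ` and every `T > 0` there is ONE constant `A` (parameters and `T`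
only) such that for every window radius `ℓ` there is an excluded boundary width `b` with: for every `N`, response coefficient
`d`, kinetic response profile `θ` (same limit clauses as in `LocalOhm`), every bulk centre `x` (`b + ℓ ≤ x`, `x + ℓ + b + 2 ≤ N`),
every continuous polynomially bounded observable `ψ` of the window sites `x-ℓ, …, x+ℓ+1` and every response limit
`ρ = lim_{δ→0,δ≠0} (μ_{N,T+δ/2,T-δ/2}(ψ) - μ_{N,T,T}(ψ))/δ`:
`|ρ - θ(x) · Cov_{μ_{N,T,T}}(ψ, H_N)/T²| ≤ A √(ℓ+1) · ‖ψ‖_{L²(μ_{N,T,T})} · (|d|/(N-1) + WV_x(ℓ))`,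
`WV_x(ℓ) = Σ_{|i-x| ≤ ℓ} |θ(i+1) - θ(i)|`. Verbatim the c3/c4 stub `stub_linearisedLTE` with the dependence of its constant on
`ℓ` fixed at `√(ℓ+1)`: this growth is forced by the LTE-gradient part of the response inside the window
(`‖Σ_{|i-x|≤ℓ} (θ_i - θ_x)(e_i - ⟨e_i⟩)‖₂ ≍ ℓ^{3/2}|∇θ|` against `A(ℓ) WV_x(ℓ) ≍ A(ℓ) ℓ |∇θ|`) and is attained at the harmonic
corner (Gaussian computation of worker-S1, lead c3), so S1♯ is the natural form of S1; it is what makes the extracted functional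
`√n`-regular. Why it might fail: as S1 (window limits of the normalised response may lose locality; the response density may not
be window-`L²` uniformly in `N`), plus: the non-equilibrium (current) part of the window response could have `L²`-size `≫ √ℓ |j|`.
Leans on: `FiniteResponseProfile_holds`, `NessUnique_holds`, fixed-`N` McLennan/Kubo identity (worker-S1 of c4: S1 ⟸ (E)
InteriorGreenKuboLocality ∧ (E2) first-moment static clustering, both `N`-uniform and unprinted). -/
theorem stub_linearisedLTESharp :
    ∀ ω₂ lam β γ : ℝ, 0 < ω₂ → 0 < lam → 0 < β → 0 < γ →
    (∀ (N : ℕ) (T_L T_R : ℝ), 0 < T_L → 0 < T_R → ∀ μ ν : Measure (PhaseSpace N),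
      (pinnedChain ω₂ lam β γ).IsSteadyState N T_L T_R μ →
      (pinnedChain ω₂ lam β γ).IsSteadyState N T_L T_R ν → μ = ν) →
    ∀ μ : (N : ℕ) → ℝ → ℝ → Measure (PhaseSpace N),
    (∀ (N : ℕ) (T_L T_R : ℝ), 0 < T_L → 0 < T_R →
      (pinnedChain ω₂ lam β γ).IsSteadyState N T_L T_R (μ N T_L T_R)) →
    ∀ T : ℝ, 0 < T →
    ∃ A : ℝ, ∀ ℓ : ℕ, ∃ b : ℕ, ∀ (N : ℕ) (d : ℝ) (θ : Fin N → ℝ),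
      Tendsto (fun δ : ℝ => (pinnedChain ω₂ lam β γ).totalCurrent (μ N (T + δ / 2) (T - δ / 2)) / δ)
        (𝓝[≠] 0) (𝓝 d) →
      (∀ i : Fin N, Tendsto (fun δ : ℝ => ((∫ x, (x.2 i) ^ 2 ∂(μ N (T + δ / 2) (T - δ / 2))) -
        ∫ x, (x.2 i) ^ 2 ∂(μ N T T)) / δ) (𝓝[≠] 0) (𝓝 (θ i))) →
      ∀ x : ℕ, b + ℓ ≤ x → x + ℓ + b + 2 ≤ N →
      ∀ ψ : PhaseSpace N → ℝ, Continuous ψ →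
        (∀ z z' : PhaseSpace N, (∀ i : Fin N, x ≤ i.val + ℓ → i.val ≤ x + ℓ + 1 →
          z.1 i = z'.1 i ∧ z.2 i = z'.2 i) → ψ z = ψ z') →
        (∃ (C₀ : ℝ) (m : ℕ), ∀ z, |ψ z| ≤ C₀ * (1 + ‖z‖) ^ m) →
        ∀ ρ : ℝ, Tendsto (fun δ : ℝ => ((∫ z, ψ z ∂(μ N (T + δ / 2) (T - δ / 2))) -
          ∫ z, ψ z ∂(μ N T T)) / δ) (𝓝[≠] 0) (𝓝 ρ) →
        |ρ - (∑ i : Fin N, if i.val = x then θ i else 0) *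
            (((∫ z, ψ z * (pinnedChain ω₂ lam β γ).hamiltonian N z ∂(μ N T T)) -
              (∫ z, ψ z ∂(μ N T T)) * (∫ z, (pinnedChain ω₂ lam β γ).hamiltonian N z ∂(μ N T T))) /
              T ^ 2)| ≤
          A * Real.sqrt ((ℓ : ℝ) + 1) * Real.sqrt (∫ z, (ψ z) ^ 2 ∂(μ N T T)) *
            (|d| / ((N : ℝ) - 1) + ∑ i : Fin N, ∑ j : Fin N,
              (if j.val = i.val + 1 ∧ x ≤ i.val + ℓ ∧ i.val ≤ x + ℓ then |θ j - θ i| else 0)) := by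
  sorry

/-! ## The extraction in the `√n` class: `blowUpLimitSqrt` (T♯1 `stub_softExtractionWeakSqrt` LANDED, p162063) -/

/-- **`blowUpLimitSqrt`** — the extraction in the `√n` class, PROVED from the landed T♯1 `LocalOhmBirth.stub_softExtractionWeakSqrt`
(p162063) and the landed packages (no `sorry` anywhere in its cone except S1♯ when fed below):
in the frame of `LocalOhm`, GIVEN (A♯) and a violating sequence, there are a shift-invariant Gibbs state `μinf` and a functional
`Λ` which is (1) linear, (2♯) `√n`-regular, (3) `liouvilleZ`-invariant, (4) of unit current on every bond. -/
theorem blowUpLimitSqrt :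
    ∀ ω₂ lam β γ : ℝ, 0 < ω₂ → 0 < lam → 0 < β → 0 < γ →
    (∀ (N : ℕ) (T_L T_R : ℝ), 0 < T_L → 0 < T_R → ∀ μ ν : Measure (PhaseSpace N),
      (pinnedChain ω₂ lam β γ).IsSteadyState N T_L T_R μ →
      (pinnedChain ω₂ lam β γ).IsSteadyState N T_L T_R ν → μ = ν) →
    ∀ μ : (N : ℕ) → ℝ → ℝ → Measure (PhaseSpace N),
    (∀ (N : ℕ) (T_L T_R : ℝ), 0 < T_L → 0 < T_R →
      (pinnedChain ω₂ lam β γ).IsSteadyState N T_L T_R (μ N T_L T_R)) →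
    ∀ T : ℝ, 0 < T →
    (∃ A : ℝ, ∀ ℓ : ℕ, ∃ b : ℕ, ∀ (N : ℕ) (d : ℝ) (θ : Fin N → ℝ),
      Tendsto (fun δ : ℝ => (pinnedChain ω₂ lam β γ).totalCurrent (μ N (T + δ / 2) (T - δ / 2)) / δ)
        (𝓝[≠] 0) (𝓝 d) →
      (∀ i : Fin N, Tendsto (fun δ : ℝ => ((∫ x, (x.2 i) ^ 2 ∂(μ N (T + δ / 2) (T - δ / 2))) -
        ∫ x, (x.2 i) ^ 2 ∂(μ N T T)) / δ) (𝓝[≠] 0) (𝓝 (θ i))) →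
      ∀ x : ℕ, b + ℓ ≤ x → x + ℓ + b + 2 ≤ N →
      ∀ ψ : PhaseSpace N → ℝ, Continuous ψ →
        (∀ z z' : PhaseSpace N, (∀ i : Fin N, x ≤ i.val + ℓ → i.val ≤ x + ℓ + 1 →
          z.1 i = z'.1 i ∧ z.2 i = z'.2 i) → ψ z = ψ z') →
        (∃ (C₀ : ℝ) (m : ℕ), ∀ z, |ψ z| ≤ C₀ * (1 + ‖z‖) ^ m) →
        ∀ ρ : ℝ, Tendsto (fun δ : ℝ => ((∫ z, ψ z ∂(μ N (T + δ / 2) (T - δ / 2))) -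
          ∫ z, ψ z ∂(μ N T T)) / δ) (𝓝[≠] 0) (𝓝 ρ) →
        |ρ - (∑ i : Fin N, if i.val = x then θ i else 0) *
            (((∫ z, ψ z * (pinnedChain ω₂ lam β γ).hamiltonian N z ∂(μ N T T)) -
              (∫ z, ψ z ∂(μ N T T)) * (∫ z, (pinnedChain ω₂ lam β γ).hamiltonian N z ∂(μ N T T))) /
              T ^ 2)| ≤
          A * Real.sqrt ((ℓ : ℝ) + 1) * Real.sqrt (∫ z, (ψ z) ^ 2 ∂(μ N T T)) *
            (|d| / ((N : ℝ) - 1) + ∑ i : Fin N, ∑ j : Fin N,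
              (if j.val = i.val + 1 ∧ x ≤ i.val + ℓ ∧ i.val ≤ x + ℓ then |θ j - θ i| else 0))) →
    ∀ (Nk : ℕ → ℕ) (dk : ℕ → ℝ) (θk : (k : ℕ) → Fin (Nk k) → ℝ) (xk : ℕ → ℕ),
    (∀ k : ℕ, Tendsto (fun δ : ℝ =>
        (pinnedChain ω₂ lam β γ).totalCurrent (μ (Nk k) (T + δ / 2) (T - δ / 2)) / δ) (𝓝[≠] 0) (𝓝 (dk k))) →
    (∀ (k : ℕ) (i : Fin (Nk k)), Tendsto (fun δ : ℝ =>
        ((∫ x, (x.2 i) ^ 2 ∂(μ (Nk k) (T + δ / 2) (T - δ / 2))) - ∫ x, (x.2 i) ^ 2 ∂(μ (Nk k) T T)) / δ)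
        (𝓝[≠] 0) (𝓝 (θk k i))) →
    (∀ k : ℕ, k ≤ xk k) → (∀ k : ℕ, xk k + k + 2 ≤ Nk k) →
    (∀ k : ℕ, (k : ℝ) * ∑ i : Fin (Nk k), ∑ j : Fin (Nk k),
        (if j.val = i.val + 1 ∧ xk k ≤ i.val + k ∧ i.val ≤ xk k + k then |θk k j - θk k i| else 0) <
      |dk k| / ((Nk k : ℝ) - 1)) →
    ∃ (μinf : Measure ChainConfig) (Λ : (ChainConfig → ℝ) → ℝ),
      (pinnedChain ω₂ lam β γ).IsChainGibbsMeasure T μinf ∧ IsShiftInvariant μinf ∧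
      (∀ (a : ℤ) (n : ℕ) (c₁ c₂ : ℝ) (g₁ g₂ : (Fin (n + 1) → ℝ × ℝ) → ℝ), Continuous g₁ → Continuous g₂ →
        (∃ (C₀ : ℝ) (m : ℕ), ∀ y, |g₁ y| ≤ C₀ * (1 + ‖y‖) ^ m ∧ |g₂ y| ≤ C₀ * (1 + ‖y‖) ^ m) →
        Λ ((fun y => c₁ * g₁ y + c₂ * g₂ y) ∘ boxRestrictAt a n) =
          c₁ * Λ (g₁ ∘ boxRestrictAt a n) + c₂ * Λ (g₂ ∘ boxRestrictAt a n)) ∧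
      (∃ A : ℝ, ∀ (n : ℕ) (a : ℤ) (g : (Fin (n + 1) → ℝ × ℝ) → ℝ), Continuous g →
        (∃ (C₀ : ℝ) (m : ℕ), ∀ y, |g y| ≤ C₀ * (1 + ‖y‖) ^ m) →
        |Λ (g ∘ boxRestrictAt a n)| ≤
          A * Real.sqrt ((n : ℝ) + 1) * Real.sqrt (∫ σ, (g (boxRestrictAt a n σ)) ^ 2 ∂μinf)) ∧
      (∀ (a : ℤ) (n : ℕ) (G : (Fin (n + 1) → ℝ × ℝ) → ℝ), ContDiff ℝ 1 G →
        (∃ (C₀ : ℝ) (m : ℕ), ∀ y, |G y| ≤ C₀ * (1 + ‖y‖) ^ m ∧ ‖fderiv ℝ G y‖ ≤ C₀ * (1 + ‖y‖) ^ m) →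
        Λ (liouvilleZ (pinnedChain ω₂ lam β γ) (G ∘ boxRestrictAt a n)) = 0) ∧
      (∀ i : ℤ, Λ (fun σ => (pinnedChain ω₂ lam β γ).bondCurrentZ σ i) = 1) := by
  intro ω₂ lam β γ hω hl hβ hγ hU μ hμ T hT hA Nk dk θk xk hD hΘ hx₁ hx₂ hlt
  obtain ⟨μinf, hG, hS, hb1, hb1', hb2b, hb2c, hb3, hb4⟩ :=
    equilibriumPackageWeak ω₂ lam β γ hω hl hβ hγ T hT
  obtain ⟨Λ, h⟩ := stub_softExtractionWeakSqrt ω₂ lam β γ hω hl hβ hγ hU μ hμ T hT hA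
    (stub_finiteResponsePackage ω₂ lam β γ hω hl hβ hγ hU μ hμ T hT) μinf hG hS hb1 hb1' hb2b hb2c
    hb3 hb4 Nk dk θk xk hD hΘ hx₁ hx₂ hlt
  exact ⟨μinf, Λ, hG, hS, h⟩

/-! ## VZD — variational zero current Drude weight in the odd sector (the anharmonic heart; OPEN) -/

/-- **VZD `stub_zeroDrudeVar`** (VARIATIONAL ZERO CURRENT DRUDE WEIGHT, odd sector; size XL, open-problem strength; the HARDEST
stub, carrying all the anharmonicity of the rigidity half; RESHAPED 2026-08-17 by lead c5 from `stub_oddSectorLiouvilleSym`).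
For `P = pinnedChain ω₂ lam β γ` (all `> 0`), `T > 0` and a shift-invariant Gibbs state `μ∞` of the infinite chain (unique:
`pinnedChain_eq_of_isChainGibbsMeasure_of_isShiftInvariant`): for every `ε > 0` there are a box `{a, …, a+n}`, a `C¹`
polynomially bounded profile `G` (with polynomially bounded derivative) and a continuous polynomially bounded momentum-EVEN
profile `E` such that the translates `f_x = j_x − 𝒜(G ∘ box_{a+x,n}) − E ∘ box_{a+x,n}` of the corrected current density have
block sums with `∫ (Σ_{x=0}^{M} f_x)² dμ∞ ≤ ε (M + 1)` for arbitrarily large `M`. Reading: `(M+1)⁻¹ ∫ (Σ_{x≤M} f_x)²` converges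
(exponential ρ-mixing of `μ∞`, in tree) to the ZERO-WAVENUMBER seminorm `‖f_0‖²_{ℋ₀} = Σ_z Cov(f_0, f_0 ∘ τ_z)` (the `E`-freedom
absorbs the mean), so the statement says `inf_{G, E} ‖j_0 − 𝒜G − E‖_{ℋ₀} = 0`: modulo momentum-even densities, the energy current
density is an `ℋ₀`-limit of microscopic time derivatives of local observables — zero current Drude weight in its variational
(resolvent) form, with no infinite-volume dynamics and no functional in the statement. Why plausibly true: a finite Green–Kubo
conductivity without Drude atom gives it formally (`u_z = (z − 𝒜)⁻¹ j`, `j = z u_z − 𝒜 u_z`, `‖z u_z‖²_{ℋ₀} = z · Re⟨⟨j, u_z⟩⟩ → 0`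
as `z ↓ 0`, then localise `u_z`), and normal conductivity of the pinned anharmonic chain is the numerical consensus (BLR2000 §10,
AokiKusnezov2000, LepriLiviPoliti2003 §6). Calibration: FALSE at `lam = β = 0`, KERNEL-CHECKED
(`LocalOhmBirth.zeroDrudeVar_false_harmonic`, `Theorems/LocalOhmBVLocalOhmHarmonicCounterexample.lean`, p166540) — the harmonic energy
current `J = Σ_x j_x` is conserved (`𝒜 j_x = ½(u_x − u_{x+1})`, `u_x = p_x² − ω₂ q_x² + r_x r_{x-1}`), so the static current functional
`Σ_z Cov(·, j_z)/c` is linear, `√n`-regular, `𝒜`-invariant with unit current, which the bridge T♯4 (in its `lam, β ≥ 0` form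
`noUnitCurrent_of_zeroDrudeVar_nonneg`, p164021) excludes under VZD; hence a proof must use `lam, β > 0`. Relation to the old
stub: in the `√n`-regular class `stub_oddSectorLiouvilleSym` ⟺ VZD (⇐ is T♯4; ⇒ by Riesz representation of `ℋ₀`-bounded
functionals and `ρ`-mixing), and the extraction fed with S1♯ only produces that class — the completeness excess of the old stub
is gone. Relation to other routes: implies the current case of `NoHiddenChargesKubo.NoOddDrudeWeight` (stmt-17667) for every
clustering dynamics extending `𝒜` (von Neumann), and is what `FourierGreenKubo`-type lines need; candidates to SHARE.
Why it might fail: a quasi-local momentum-odd conserved charge of the anharmonic pinned chain overlapping the current (positive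
Drude weight — kills every Green–Kubo line too), or `j_0 ⊥`-residue in `ℋ₀` not reachable by LOCAL `G` (core failure).
Leans on: `InfiniteChainGibbsStationarity(Pinned)` (`∫ 𝒜F dμ∞ = 0`), `IsChainGibbsMeasure.map_momentumReversalZ`,
`exists_regular_state_mixing_pinnedChain`, route support `NoLocalIntegrals` (no LOCAL odd charge — the finite-range shadow),
`Literature.Barriers.AtomisticToContinuum.Mazur1969_inequality`, `MacroErgodicityBarrier` (engaged: this IS a `k = 0`
ergodicity statement of the infinite deterministic dynamics, now in its weakest, shared form). -/
theorem stub_zeroDrudeVar :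
    ∀ ω₂ lam β γ : ℝ, 0 < ω₂ → 0 < lam → 0 < β → 0 < γ → ∀ T : ℝ, 0 < T →
    ∀ μinf : Measure ChainConfig, (pinnedChain ω₂ lam β γ).IsChainGibbsMeasure T μinf →
    IsShiftInvariant μinf →
    ∀ ε : ℝ, 0 < ε → ∃ (a : ℤ) (n : ℕ) (G E : (Fin (n + 1) → ℝ × ℝ) → ℝ),
      ContDiff ℝ 1 G ∧
      (∃ (C₀ : ℝ) (m : ℕ), ∀ y, |G y| ≤ C₀ * (1 + ‖y‖) ^ m ∧ ‖fderiv ℝ G y‖ ≤ C₀ * (1 + ‖y‖) ^ m) ∧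
      Continuous E ∧ (∃ (C₀ : ℝ) (m : ℕ), ∀ y, |E y| ≤ C₀ * (1 + ‖y‖) ^ m) ∧
      (∀ y, E (fun i => ((y i).1, -(y i).2)) = E y) ∧
      ∀ M₀ : ℕ, ∃ M : ℕ, M₀ ≤ M ∧
        (∫ σ, (∑ x ∈ Finset.range (M + 1),
            ((pinnedChain ω₂ lam β γ).bondCurrentZ σ (x : ℤ) -
              liouvilleZ (pinnedChain ω₂ lam β γ) (G ∘ boxRestrictAt (a + (x : ℤ)) n) σ -
              E (boxRestrictAt (a + (x : ℤ)) n σ))) ^ 2 ∂μinf) ≤ ε * ((M : ℝ) + 1) := by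
  sorry

/-! ## T♯4 — the bridge `stub_noUnitCurrent_of_zeroDrudeVar` is LANDED (p163112): VZD ⇒ no linear, `√n`-regular, invariant
functional with unit current on every bond (odd part inside the proof, block sums instead of shift averages, `μ_T ∘ R = μ_T`). -/

/-! ## The composition: `LocalOhm` from S1♯ and VZD (T♯1, T♯4 landed) -/

/-- **`LocalOhm_of`** — the kernel-checked composition (no `sorry` of its own): if `LocalOhm` fails, the diagonal choice
`C = ℓ = b = k` gives a violating sequence; `blowUpLimitSqrt` (S1♯ `stub_linearisedLTESharp` + T♯1 `stub_softExtractionWeakSqrt` +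
the landed packages) extracts a shift-invariant Gibbs state `μinf` and a linear, `√n`-regular, invariant functional with unit
current on every bond; T♯4 `stub_noUnitCurrent_of_zeroDrudeVar` fed with VZD `stub_zeroDrudeVar` at `μinf` says no such functional
exists. The stubs are invoked by name (the skeleton audit admits only named obligations as binders). -/
theorem LocalOhm_of : LocalOhm := by
  intro ω₂ lam β γ hω hl hβ hγ hU μ hμ T hT
  by_contra hneg
  -- with `C = ℓ = b = k` the local Ohm inequality fails at some bulk bond, for every `k`
  have hk : ∀ k : ℕ, ∃ (N : ℕ) (d : ℝ) (θ : Fin N → ℝ),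
      Tendsto (fun δ : ℝ => (pinnedChain ω₂ lam β γ).totalCurrent (μ N (T + δ / 2) (T - δ / 2)) / δ)
        (𝓝[≠] 0) (𝓝 d) ∧
      (∀ i : Fin N, Tendsto (fun δ : ℝ => ((∫ x, (x.2 i) ^ 2 ∂(μ N (T + δ / 2) (T - δ / 2))) -
        ∫ x, (x.2 i) ^ 2 ∂(μ N T T)) / δ) (𝓝[≠] 0) (𝓝 (θ i))) ∧
      ∃ x : ℕ, k ≤ x ∧ x + k + 2 ≤ N ∧
        (k : ℝ) * ∑ i : Fin N, ∑ j : Fin N,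
            (if j.val = i.val + 1 ∧ x ≤ i.val + k ∧ i.val ≤ x + k then |θ j - θ i| else 0) <
          |d| / ((N : ℝ) - 1) := by
    intro k
    by_contra hk'
    push Not at hk'
    exact hneg ⟨(k : ℝ), k, k, fun N d θ hd hθ x hx₁ hx₂ => hk' N d θ hd hθ x hx₁ hx₂⟩
  choose Nk dk θk hD hΘ xk hx₁ hx₂ hlt using hk
  -- blow-up in the `√n` class: a bad first-order functional on the infinite chain
  obtain ⟨μinf, Λ, hGibbs, hshift, hlin, hbd, hinv, hcur⟩ :=
    blowUpLimitSqrt ω₂ lam β γ hω hl hβ hγ hU μ hμ T hT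
      (stub_linearisedLTESharp ω₂ lam β γ hω hl hβ hγ hU μ hμ T hT) Nk dk θk xk hD hΘ hx₁ hx₂ hlt
  -- rigidity: variational zero current Drude weight at `μinf`, through the bridge
  exact stub_noUnitCurrent_of_zeroDrudeVar ω₂ lam β γ hω hl hβ hγ T hT μinf hGibbs hshift
    (stub_zeroDrudeVar ω₂ lam β γ hω hl hβ hγ T hT μinf hGibbs hshift) Λ hlin hbd hinv hcur

/-- The crux item stmt-AtomisticToContinuum-12009 is SHARED: route `TransferKernelPositivity` files the byte-identical statement
as `TransferKernelPositivity.LocalOhm` (rank 3 there). The two decls are definitionally equal, so the same skeleton concludes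
that copy too. -/
theorem LocalOhm_of_transferKernelPositivity :
    Summit.AtomisticToContinuum.FouriersLaw.Theses.TransferKernelPositivity.LocalOhm := LocalOhm_of

end Summit.AtomisticToContinuum.FouriersLaw.Cruxes.LocalOhm.Birth

end
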